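import Literature.Probability.Percolation.QuadCrossingConformalChart
import Literature.Probability.Percolation.QuadCrossingNullFrontierFamilies
import Literature.Analysis.FunctionSpaces.BVLevelSetsLocal
import HarnessLib

/-!
# General position for Schramm–Smirnov's Theorem 1.7

Topic `Literature/Probability/Percolation`; proofs only.  Schramm–Smirnov prove their discrete
gluing Theorem 1.1 and the mesh-independent gluing Proposition 4.1 (*On the scaling limits of
planar percolation*, Ann. Probab. 39 (2011)) for quads in general position with respect to the
cut `α`: "approximating if necessary, we can assume that `α` intersects `∂Q₀` at finitely many
points. (… `α` has finite length and so for almost every `ε` the intersection `α ∩ ∂Q^ε` is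
finite; we may then replace `Q₀` with `Q^ε` …)" (§2), the nicer quads being produced "e.g. using the
Riemann map" (proof of Lemma 5.1).  Here this reduction is carried out for Theorem 1.7 in the form
its tree proof needs (`QuadCrossingNullFrontier.lean`: Thm. 1.7 follows from the conclusion of
Prop. 4.1 at every quad of a DENSE family of `μ`-continuity quads):

* `dense_setOf_null_frontier_and_finite_inter` — **for every finite Borel measure `μ` on `ℋ_D`
  and every finite union `α` of finite-length paths, the quads `Q` with `μ(∂⊞_Q) = 0` and
  `α ∩ ∂[Q]` finite are dense in `𝒬_D`.**  Proof: read `Q` through its conformal square chart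
  `H` (`exists_conformalChart`, `QuadCrossingConformalChart.lean`: `Q = (H ∘ chart) ∘ k`, `H⁻¹`
  locally Lipschitz inside `[Q]`), shrink the chart (`z ↦ H((1-u)z)`), and run the perturbation
  family `shrinkFamily` reparametrised by `k`: its members are uniformly close to `Q`, all but
  countably many are `μ`-continuity quads (`QuadCrossingNullFrontierFamilies.lean`), and their
  boundaries `H((1-u) ∂([-(1-s), 1-s] × [-(1+s), 1+s]))` are level sets of the two Lipschitz
  functions `1 - |re H⁻¹|/(1-u)`, `|im H⁻¹|/(1-u) - 1`, which the cut meets finitely often for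
  a.e. `s` (`ae_finite_levelSet_inter_of_isCompact`, `BVLevelSetsLocal.lean`: Banach indicatrix
  along the finitely many finite-length paths, pulled back through the locally Lipschitz `H⁻¹`).
* `SchrammSmirnov2011_thm_1_7_of_frequently_gluing_finite_inter` — hence Theorem 1.7 follows
  from the (mesh-dependent, "frequently along the sequence") conclusion of Prop. 4.1 required ONLY
  at `μ`-continuity quads `Q₀` with `α ∩ ∂[Q₀]` finite.

## References

* O. Schramm, S. Smirnov, Ann. Probab. 39 (2011) 1768–1814, arXiv:1101.5820, Thm. 1.7 and its
  proof, §2 (general position), Lemma 5.1 (proof), Prop. 4.1. [SchrammSmirnov2011]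
-/

noncomputable section

open Set Metric Filter MeasureTheory Complex
open scoped unitInterval Topology Real NNReal ENNReal symmDiff
open Literature.Probability.RandomPlanarGeometry Literature.Topology.PlaneTopology
open Literature.Analysis.FunctionSpaces

namespace Literature.Probability.Percolation

namespace QuadCrossing

variable {D : Set ℂ}

/-! ### Rectangles read through the chart -/

/-- The range of `rectMap a b` is the closed rectangle `[-a, a] × [-b, b]` (`a, b > 0`). [folklore] -/
theorem range_rectMap {a b : ℝ} (ha : 0 < a) (hb : 0 < b) :
    range (Quad.rectMap a b) = Icc (-a) a ×ℂ Icc (-b) b := by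
  refine Subset.antisymm ?_ fun z hz => ?_
  · rintro _ ⟨p, rfl⟩
    rw [mem_reProdIm, (Quad.rectMap_re_im a b p).1, (Quad.rectMap_re_im a b p).2]
    have h1 := Quad.abs_two_mul_sub_one_le p.1
    have h2 := Quad.abs_two_mul_sub_one_le p.2
    rw [abs_le] at h1 h2
    exact ⟨⟨by nlinarith, by nlinarith⟩, ⟨by nlinarith, by nlinarith⟩⟩
  · rw [mem_reProdIm] at hz
    obtain ⟨⟨h1, h2⟩, h3, h4⟩ := hz
    refine ⟨(⟨(z.re / a + 1) / 2, ?_⟩, ⟨(z.im / b + 1) / 2, ?_⟩), ?_⟩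
    · constructor
      · have : -1 ≤ z.re / a := by rw [le_div_iff₀ ha]; linarith
        linarith
      · have : z.re / a ≤ 1 := by rw [div_le_iff₀ ha]; linarith
        linarith
    · constructor
      · have : -1 ≤ z.im / b := by rw [le_div_iff₀ hb]; linarith
        linarith
      · have : z.im / b ≤ 1 := by rw [div_le_iff₀ hb]; linarith
        linarith
    · apply Complex.ext
      · rw [(Quad.rectMap_re_im a b _).1]; simp only []; field_simp; ring
      · rw [(Quad.rectMap_re_im a b _).2]; simp only []; field_simp; ring

/-- Scaling the chart: `c · rectMap a b p = rectMap (c a) (c b) p`. [folklore] -/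
theorem smul_rectMap (c a b : ℝ) (p : I × I) :
    (c : ℂ) * Quad.rectMap a b p = Quad.rectMap (c * a) (c * b) p := by
  apply Complex.ext
  · rw [(Quad.rectMap_re_im _ _ p).1, Complex.re_ofReal_mul, (Quad.rectMap_re_im a b p).1]; ring
  · rw [(Quad.rectMap_re_im _ _ p).2, Complex.im_ofReal_mul, (Quad.rectMap_re_im a b p).2]; ring

/-- Two chart points of the same parameter point are `|a - a'| + |b - b'|` close. [folklore] -/
theorem dist_rectMap_rectMap_le (a b a' b' : ℝ) (p : I × I) :
    dist (Quad.rectMap a b p) (Quad.rectMap a' b' p) ≤ |a - a'| + |b - b'| := by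
  rw [dist_eq_norm]
  have h : Quad.rectMap a b p - Quad.rectMap a' b' p =
      ((((a - a') * (2 * (p.1 : ℝ) - 1)) : ℝ) : ℂ) + ((((b - b') * (2 * (p.2 : ℝ) - 1)) : ℝ) : ℂ) * Complex.I := by
    simp only [Quad.rectMap]; push_cast; ring
  rw [h]
  refine (norm_add_le _ _).trans ?_
  rw [norm_mul, Complex.norm_I, mul_one, Complex.norm_real, Complex.norm_real, Real.norm_eq_abs,
    Real.norm_eq_abs, abs_mul, abs_mul]
  have h1 := Quad.abs_two_mul_sub_one_le p.1
  have h2 := Quad.abs_two_mul_sub_one_le p.2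
  nlinarith [abs_nonneg (a - a'), abs_nonneg (b - b')]

/-- The frontier of a closed rectangle lies on the four lines `|re| = a`, `|im| = b` (`a, b > 0`).
[folklore] -/
theorem frontier_Icc_reProdIm_subset {a b : ℝ} (ha : 0 < a) (hb : 0 < b) :
    frontier (Icc (-a) a ×ℂ Icc (-b) b) ⊆ {z : ℂ | |z.re| = a} ∪ {z : ℂ | |z.im| = b} := by
  rw [frontier_reProdIm, closure_Icc, closure_Icc, frontier_Icc (by linarith), frontier_Icc (by linarith)]
  rintro z (⟨-, hz⟩ | ⟨hz, -⟩)
  · right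
    rcases hz with h | h
    · rw [mem_setOf_eq, h, abs_neg, abs_of_pos hb]
    · rw [mem_singleton_iff] at h; rw [mem_setOf_eq, h, abs_of_pos hb]
  · left
    rcases hz with h | h
    · rw [mem_setOf_eq, h, abs_neg, abs_of_pos ha]
    · rw [mem_singleton_iff] at h; rw [mem_setOf_eq, h, abs_of_pos ha]

/-! ### Paths of the cut, extended to the line -/

/-- A path of bounded variation on `[0,1]`, extended constantly, has bounded variation on
`[0, 1] ⊆ ℝ`. [folklore] -/
theorem boundedVariationOn_comp_projIcc {γ : I → ℂ} (hγ : BoundedVariationOn γ univ) :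
    BoundedVariationOn (fun t : ℝ => γ (projIcc 0 1 zero_le_one t)) (Icc 0 1) := by
  have h := eVariationOn.comp_eq_of_monotoneOn γ (t := Icc (0 : ℝ) 1) (projIcc 0 1 zero_le_one)
    ((monotone_projIcc zero_le_one).monotoneOn _)
  have himg : projIcc (0 : ℝ) 1 zero_le_one '' Icc 0 1 = univ := by
    refine eq_univ_of_forall fun x => ⟨x, x.2, projIcc_val zero_le_one x⟩
  rw [himg] at h
  show eVariationOn _ _ ≠ ⊤
  rw [show (fun t : ℝ => γ (projIcc 0 1 zero_le_one t)) = γ ∘ projIcc 0 1 zero_le_one from rfl, h]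
  exact hγ

/-! ### The density theorem -/

/-- **Continuity quads in general position with respect to the cut are dense.**  For `D` open,
a finite Borel measure `μ` on `ℋ_D` and a finite union `α` of finite-length paths, the quads `Q`
with `μ(∂⊞_Q) = 0` AND `α ∩ ∂[Q]` finite are dense in `𝒬_D`.  Proof: read `Q` through its
conformal square chart `H` (`exists_conformalChart`), shrink the chart slightly
(`z ↦ H((1-u)z)`), run the perturbation family `shrinkFamily` reparametrised by the side-preserving
`k` — its members are `ε`-close to `Q` (uniform continuity of `H` on `[-1,1]²`), their crossing
events increase and they are strictly ordered (`shrinkFamily_reparam_hypotheses`), so all but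
countably many are `μ`-continuity quads (`QuadCrossingNullFrontierFamilies`); and their boundaries
are the `H`-images of the boundaries of the rectangles `(1-u)[-(1-s), 1-s] × [-(1+s), 1+s]`,
level sets `{g₁ = s} ∪ {g₂ = s}` of two Lipschitz functions of `H⁻¹`, which the finite-length
cut meets finitely often for a.e. `s` (`ae_finite_levelSet_inter_of_isCompact` with the local
Lipschitz continuity of `H⁻¹` inside `[Q]`).  A parameter good for both exists.
[cite: SchrammSmirnov2011, §2 ("approximating if necessary, we can assume that α intersects ∂Q₀ at finitely many points") and proof of Lemma 5.1] -/
theorem dense_setOf_null_frontier_and_finite_inter (μ : Measure (QuadConfig D))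
    [IsFiniteMeasure μ] {α : Set ℂ} (hα : IsFiniteLengthPathUnion α) :
    Dense {Q : Quad D | μ (frontier (QuadConfig.crossedEvent Q)) = 0 ∧
      (α ∩ frontier Q.carrier).Finite} := by
  classical
  refine Metric.dense_iff.2 fun Q ε hε => ?_
  obtain ⟨H, k, hk, hHQ, hHS, hLip⟩ := exists_conformalChart Q
  set S : Set ℂ := Icc (-1 : ℝ) 1 ×ℂ Icc (-1 : ℝ) 1 with hS
  have hScpt : IsCompact S := by
    rw [hS, ← closure_symRect one_pos one_pos]; exact (isBounded_symRect 1 1).isCompact_closure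
  -- uniform continuity of `H` on the closed square
  obtain ⟨η, hη, hHuc⟩ : ∃ η > 0, ∀ z ∈ S, ∀ w ∈ S, dist z w < η → dist (H z) (H w) < ε / 2 :=
    Metric.uniformContinuousOn_iff.1 (hScpt.uniformContinuousOn_of_continuous H.continuous.continuousOn)
      (ε / 2) (half_pos hε)
  -- the shrink factor `c = 1 - u`
  set u : ℝ := min (1 / 4) (η / 8) with hu
  have hu0 : 0 < u := lt_min (by norm_num) (by positivity)
  have hu4 : u ≤ 1 / 4 := min_le_left _ _
  have huη : u ≤ η / 8 := min_le_right _ _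
  set c : ℝ := 1 - u with hc
  have hc0 : 0 < c := by rw [hc]; linarith
  have hc1 : c ≤ 1 := by rw [hc]; linarith
  have hcτ : c * (1 + u) ≤ 1 := by rw [hc]; nlinarith
  have hcτ' : c * (1 + u) < 1 := by rw [hc]; nlinarith
  set dil : ℂ ≃ₜ ℂ := Homeomorph.mulLeft₀ (c : ℂ) (by exact_mod_cast hc0.ne') with hdil
  have hdil_apply : ∀ z, dil z = (c : ℂ) * z := fun z => rfl
  set Hc : ℂ ≃ₜ ℂ := dil.trans H with hHc
  have hHc_apply : ∀ a b p, Hc (Quad.rectMap a b p) = H (Quad.rectMap (c * a) (c * b) p) := by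
    intro a b p
    rw [hHc, Homeomorph.trans_apply, hdil_apply, smul_rectMap]
  -- rectangles with `|a|, |b| ≤ 1 + u` shrink into the closed square
  have hrect_mem : ∀ a b : ℝ, |a - 1| ≤ u → |b - 1| ≤ u → ∀ p : I × I,
      Quad.rectMap (c * a) (c * b) p ∈ S := by
    intro a b ha hb p
    rw [abs_le] at ha hb
    rw [hS, mem_reProdIm, (Quad.rectMap_re_im _ _ p).1, (Quad.rectMap_re_im _ _ p).2]
    have h1 := Quad.abs_two_mul_sub_one_le p.1
    have h2 := Quad.abs_two_mul_sub_one_le p.2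
    rw [abs_le] at h1 h2
    have hca : |c * a| ≤ 1 := by
      rw [abs_mul, abs_of_pos hc0]
      calc c * |a| ≤ c * (1 + u) := mul_le_mul_of_nonneg_left (abs_le.2 ⟨by linarith, by linarith⟩) hc0.le
        _ ≤ 1 := hcτ
    have hcb : |c * b| ≤ 1 := by
      rw [abs_mul, abs_of_pos hc0]
      calc c * |b| ≤ c * (1 + u) := mul_le_mul_of_nonneg_left (abs_le.2 ⟨by linarith, by linarith⟩) hc0.le
        _ ≤ 1 := hcτ
    rw [abs_le] at hca hcb
    refine ⟨⟨?_, ?_⟩, ⟨?_, ?_⟩⟩ <;> nlinarith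
  have hmem : ∀ a b : ℝ, |a - 1| ≤ u → |b - 1| ≤ u → ∀ p : I × I, Hc (Quad.rectMap a b p) ∈ D := by
    intro a b ha hb p
    rw [hHc_apply]
    have : H (Quad.rectMap (c * a) (c * b) p) ∈ H '' S := mem_image_of_mem H (hrect_mem a b ha hb p)
    rw [hHS] at this
    exact Q.carrier_subset this
  have hu2 : u ≤ 1 / 2 := by linarith
  set fam : ℝ → Quad D := fun s => (Quad.shrinkFamily Hc hu0.le hu2 hmem s).reparam k with hfam
  -- (i) every member is `ε`-close to `Q`
  have hclose : ∀ s, dist (fam s) Q < ε := by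
    intro s
    have hcs0 : 0 ≤ Quad.clampTo u s := (Quad.clampTo_mem hu0.le s).1
    have hcsu : Quad.clampTo u s ≤ u := (Quad.clampTo_mem hu0.le s).2
    have hpt : ∀ p, dist (fam s p) (Q p) < ε / 2 := by
      intro p
      rw [hfam]
      simp only [Quad.reparam_apply, Quad.shrinkFamily_apply]
      rw [hHc_apply, ← hHQ p]
      refine hHuc _ (hrect_mem _ _ ?_ ?_ (k p)) _ ?_ ?_
      · rw [show 1 - Quad.clampTo u s - 1 = -Quad.clampTo u s by ring, abs_neg, abs_of_nonneg hcs0]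
        exact hcsu
      · rw [show 1 + Quad.clampTo u s - 1 = Quad.clampTo u s by ring, abs_of_nonneg hcs0]; exact hcsu
      · exact rectMap_one_one_mem (k p)
      · refine lt_of_le_of_lt (dist_rectMap_rectMap_le _ _ _ _ (k p)) ?_
        rw [show c * (1 - Quad.clampTo u s) - 1 = -(u + c * Quad.clampTo u s) by rw [hc]; ring,
          show c * (1 + Quad.clampTo u s) - 1 = -(u - c * Quad.clampTo u s) by rw [hc]; ring,
          abs_neg, abs_neg]
        have h1 : |u + c * Quad.clampTo u s| ≤ 2 * u := by
          rw [abs_le]; constructor <;> nlinarith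
        have h2 : |u - c * Quad.clampTo u s| ≤ u := by
          rw [abs_le]; constructor <;> nlinarith
        linarith
    calc dist (fam s) Q ≤ ε / 2 := by
          rw [Quad.dist_eq, ContinuousMap.dist_le (half_pos hε).le]
          exact fun p => (hpt p).le
      _ < ε := by linarith
  -- (ii) crossing events increase, members strictly ordered
  obtain ⟨hmono, hstrict⟩ := Quad.shrinkFamily_reparam_hypotheses Hc hu0.le hu2 hmem hk
  -- (iii) the boundaries meet the cut finitely often, for a.e. parameter
  obtain ⟨n, γ, rfl, hγbv, -⟩ := hα
  set γe : Fin n → ℝ → ℂ := fun i t => γ i (projIcc 0 1 zero_le_one t) with hγe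
  have hγec : ∀ i, Continuous (γe i) := fun i => (γ i).continuous.comp continuous_projIcc
  have hγebv : ∀ i, BoundedVariationOn (γe i) (Icc 0 1) := fun i =>
    boundedVariationOn_comp_projIcc (hγbv i)
  set O : Set ℂ := H '' symRect 1 1 with hO
  have hOo : IsOpen O := H.isOpenMap _ (isOpen_symRect 1 1)
  -- the two level functions of the rectangle family, read through `H⁻¹`
  set g₁ : ℂ → ℝ := fun z => 1 - |z.re| / c with hg₁
  set g₂ : ℂ → ℝ := fun z => |z.im| / c - 1 with hg₂
  have hcinv : 0 ≤ 1 / c := by positivity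
  have hg₁L : LipschitzWith (1 / c).toNNReal g₁ := by
    refine LipschitzWith.of_dist_le_mul fun z w => ?_
    rw [Real.coe_toNNReal _ hcinv, Real.dist_eq, hg₁]
    simp only
    rw [show 1 - |z.re| / c - (1 - |w.re| / c) = (|w.re| - |z.re|) / c by ring, abs_div, abs_of_pos hc0,
      div_eq_mul_one_div, mul_comm]
    refine mul_le_mul_of_nonneg_left ?_ hcinv
    calc abs (|w.re| - |z.re|) ≤ |w.re - z.re| := abs_abs_sub_abs_le_abs_sub _ _
      _ = |(w - z).re| := by rw [Complex.sub_re]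
      _ ≤ ‖w - z‖ := Complex.abs_re_le_norm _
      _ = dist z w := by rw [dist_comm, dist_eq_norm]
  have hg₂L : LipschitzWith (1 / c).toNNReal g₂ := by
    refine LipschitzWith.of_dist_le_mul fun z w => ?_
    rw [Real.coe_toNNReal _ hcinv, Real.dist_eq, hg₂]
    simp only
    rw [show |z.im| / c - 1 - (|w.im| / c - 1) = (|z.im| - |w.im|) / c by ring, abs_div, abs_of_pos hc0,
      div_eq_mul_one_div, mul_comm]
    refine mul_le_mul_of_nonneg_left ?_ hcinv
    calc abs (|z.im| - |w.im|) ≤ |z.im - w.im| := abs_abs_sub_abs_le_abs_sub _ _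
      _ = |(z - w).im| := by rw [Complex.sub_im]
      _ ≤ ‖z - w‖ := Complex.abs_im_le_norm _
      _ = dist z w := by rw [dist_eq_norm]
  have hF : ∀ g : ℂ → ℝ, (∃ L, LipschitzWith L g) → ∀ x ∈ O, ∃ C : ℝ≥0, ∃ t ∈ 𝓝 x,
      LipschitzOnWith C (g ∘ H.symm) t := by
    rintro g ⟨L, hL⟩ x hx
    obtain ⟨C, t, ht, hC⟩ := hLip x hx
    exact ⟨L * C, t, ht, hL.comp_lipschitzOnWith hC⟩
  -- the compact core square containing all the rectangles of the family
  set K₀ : Set ℂ := Icc (-(c * (1 + u))) (c * (1 + u)) ×ℂ Icc (-(c * (1 + u))) (c * (1 + u)) with hK₀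
  have hK₀c : IsCompact K₀ := isCompact_Icc.reProdIm isCompact_Icc
  have hK₀sub : K₀ ⊆ symRect 1 1 := by
    intro z hz
    rw [hK₀, mem_reProdIm] at hz
    rw [mem_symRect]
    obtain ⟨⟨h1, h2⟩, h3, h4⟩ := hz
    exact ⟨⟨by linarith, by linarith⟩, by linarith, by linarith⟩
  have hHK₀c : IsCompact (H '' K₀) := hK₀c.image H.continuous
  have hHK₀O : H '' K₀ ⊆ O := image_mono hK₀sub
  set T : Fin n → Set ℝ := fun i => Icc 0 1 ∩ γe i ⁻¹' (H '' K₀) with hT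
  have hTc : ∀ i, IsCompact (T i) := fun i =>
    isCompact_Icc.inter_right (hHK₀c.isClosed.preimage (hγec i))
  have hTsub : ∀ i, T i ⊆ Icc 0 1 := fun i => inter_subset_left
  have hTO : ∀ i, MapsTo (γe i) (T i) O := fun i t ht => hHK₀O ht.2
  have hae : ∀ᵐ s ∂(volume : Measure ℝ), ∀ i,
      {t ∈ T i | (g₁ ∘ H.symm) (γe i t) = s}.Finite ∧ {t ∈ T i | (g₂ ∘ H.symm) (γe i t) = s}.Finite := by
    refine ae_all_iff.2 fun i => Filter.Eventually.and ?_ ?_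
    · exact ae_finite_levelSet_inter_of_isCompact hOo (hγec i) (hγebv i) (hF g₁ ⟨_, hg₁L⟩)
        (hTc i) (hTsub i) (hTO i)
    · exact ae_finite_levelSet_inter_of_isCompact hOo (hγec i) (hγebv i) (hF g₂ ⟨_, hg₂L⟩)
        (hTc i) (hTsub i) (hTO i)
  -- the carrier and the frontier of a member `fam s`, `0 < s < u`
  have hcarrier : ∀ s ∈ Ioo 0 u, (fam s).carrier =
      H '' (Icc (-(c * (1 - s))) (c * (1 - s)) ×ℂ Icc (-(c * (1 + s))) (c * (1 + s))) := by
    intro s hs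
    have hcl : Quad.clampTo u s = s := Quad.clampTo_of_mem hs.1.le hs.2.le
    rw [hfam]
    simp only [Quad.carrier_reparam]
    rw [Quad.carrier, ← range_rectMap (by nlinarith [hs.2]) (by nlinarith [hs.1]), ← range_comp]
    congr 1
    funext p
    simp only [Function.comp_apply, Quad.shrinkFamily_apply, hcl, hHc_apply]
  have hfin : ∀ s ∈ Ioo 0 u, (∀ i, {t ∈ T i | (g₁ ∘ H.symm) (γe i t) = s}.Finite ∧
      {t ∈ T i | (g₂ ∘ H.symm) (γe i t) = s}.Finite) →
      ((⋃ i, range (γ i)) ∩ frontier (fam s).carrier).Finite := by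
    intro s hs hfs
    set Rs : Set ℂ := Icc (-(c * (1 - s))) (c * (1 - s)) ×ℂ Icc (-(c * (1 + s))) (c * (1 + s)) with hRs
    have hs1 : 0 < c * (1 - s) := by nlinarith [hs.2]
    have hs2 : 0 < c * (1 + s) := by nlinarith [hs.1]
    have hRsK : Rs ⊆ K₀ := by
      intro z hz
      rw [hRs, mem_reProdIm] at hz
      rw [hK₀, mem_reProdIm]
      obtain ⟨⟨h1, h2⟩, h3, h4⟩ := hz
      have h5 : c * (1 - s) ≤ c * (1 + u) := mul_le_mul_of_nonneg_left (by linarith [hs.1]) hc0.le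
      have h6 : c * (1 + s) ≤ c * (1 + u) := mul_le_mul_of_nonneg_left (by linarith [hs.2]) hc0.le
      exact ⟨⟨by linarith, by linarith⟩, ⟨by linarith, by linarith⟩⟩
    have hRscl : IsClosed Rs := isClosed_Icc.reProdIm isClosed_Icc
    have hfr : frontier (fam s).carrier = H '' frontier Rs := by
      rw [hcarrier s hs, ← hRs, H.image_frontier]
    -- every point of `α ∩ ∂[fam s]` is a level point of `g₁` or `g₂` along some path
    have hsub : (⋃ i, range (γ i)) ∩ frontier (fam s).carrier ⊆
        ⋃ i, γe i '' ({t ∈ T i | (g₁ ∘ H.symm) (γe i t) = s} ∪ {t ∈ T i | (g₂ ∘ H.symm) (γe i t) = s}) := by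
      rintro x ⟨hxα, hxfr⟩
      rw [hfr] at hxfr
      obtain ⟨w, hw, rfl⟩ := hxfr
      have hwRs : w ∈ Rs := hRscl.frontier_subset hw
      have hwK : w ∈ K₀ := hRsK hwRs
      simp only [mem_iUnion] at hxα ⊢
      obtain ⟨i, t₀, ht₀⟩ := hxα
      refine ⟨i, (t₀ : ℝ), ?_, ?_⟩
      · have ht₀T : (t₀ : ℝ) ∈ T i := by
          refine ⟨t₀.2, ?_⟩
          show γe i t₀ ∈ H '' K₀
          rw [hγe]; simp only [projIcc_val]
          rw [ht₀]; exact mem_image_of_mem H hwK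
        have hlev := frontier_Icc_reProdIm_subset hs1 hs2 hw
        have hval : γe i t₀ = H w := by rw [hγe]; simp only [projIcc_val]; exact ht₀
        rcases hlev with h | h
        · left
          refine ⟨ht₀T, ?_⟩
          simp only [Function.comp_apply, hval, Homeomorph.symm_apply_apply, hg₁]
          rw [mem_setOf_eq] at h
          rw [h]; field_simp; ring
        · right
          refine ⟨ht₀T, ?_⟩
          simp only [Function.comp_apply, hval, Homeomorph.symm_apply_apply, hg₂]
          rw [mem_setOf_eq] at h
          rw [h]; field_simp; ring
      · rw [hγe]; simp only [projIcc_val]; exact ht₀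
    refine Finite.subset ?_ hsub
    exact finite_iUnion fun i => ((hfs i).1.union (hfs i).2).image _
  -- the bad parameters are Lebesgue-null
  set N : Set ℝ := {s | s ∈ Ioo 0 u ∧ ¬((⋃ i, range (γ i)) ∩ frontier (fam s).carrier).Finite} with hN
  have hNnull : (volume : Measure ℝ) N = 0 := by
    refine measure_mono_null (fun s hs => ?_) (ae_iff.1 hae)
    exact fun hall => hs.2 (hfin s hs.1 hall)
  -- (iv) a parameter good for both
  obtain ⟨s, hs, -, hsN, hnull⟩ := Quad.exists_mem_Ioo_notMem_measure_frontier_eq_zero_of_family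
    hmono hstrict hu0 μ countable_empty hNnull
  refine ⟨fam s, mem_ball.2 (hclose s), hnull, ?_⟩
  by_contra hinf
  exact hsN ⟨hs, hinf⟩

/-! ### Theorem 1.7 from Proposition 4.1 at quads in general position -/

/-- **Theorem 1.7 ⇐ the conclusion of Prop. 4.1 at continuity quads in general position.**  As
`SchrammSmirnov2011_thm_1_7_of_frequently_gluing` (`QuadCrossingNullFrontier.lean`), but the
mesh-dependent gluing hypothesis is only required for quads `Q₀` with `μ(∂⊞_{Q₀}) = 0` AND
`α ∩ ∂[Q₀]` finite — the general-position assumption under which the source proves Thm. 1.1 and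
Prop. 4.1 ("approximating if necessary, we can assume that `α` intersects `∂Q₀` at finitely many
points") — such quads being dense by `dense_setOf_null_frontier_and_finite_inter`.
[cite: SchrammSmirnov2011, Thm. 1.7 (proof), §2 and Prop. 4.1] -/
theorem SchrammSmirnov2011_thm_1_7_of_frequently_gluing_finite_inter
    (h41 : ∀ (D : Set ℂ), IsOpen D → IsConnected D →
      ∀ (μ : FiniteMeasure (QuadConfig D)) (δs : ℕ → ℝ), (∀ k, 0 < δs k) →
        Tendsto δs atTop (𝓝 0) → Tendsto (fun k => squareCrossingLaw D (δs k)) atTop (𝓝 μ) →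
      ∀ α : Set ℂ, IsFiniteLengthPathUnion α →
      ∀ Q₀ : Quad D,
        (μ : Measure (QuadConfig D)) (frontier (QuadConfig.crossedEvent Q₀)) = 0 →
        (α ∩ frontier Q₀.carrier).Finite →
      ∀ ε : ℝ, 0 < ε → ∃ F : Set (Quad D), F.Finite ∧
        (∀ Q ∈ F, Q.carrier ⊆ D \ α ∧
          (μ : Measure (QuadConfig D)) (frontier (QuadConfig.crossedEvent Q)) = 0) ∧
        ∃ᶠ k in atTop, ∃ W : Set (QuadConfig D),
          MeasurableSet[MeasurableSpace.generateFrom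
            ((fun Q => QuadConfig.crossedEvent Q) '' F)] W ∧
          (squareCrossingLaw D (δs k) : Measure (QuadConfig D))
            (W ∆ QuadConfig.crossedEvent Q₀) ≤ ENNReal.ofReal ε) :
    SchrammSmirnov2011_thm_1_7 := by
  intro D hD hD' μ hμ α hα
  obtain ⟨δs, hpos, h0, hlim⟩ := hμ
  refine aeIncluded_iSup_crossingField_of_dense SchrammSmirnov2011_thm_1_4_holds hD hD'.nonempty
    _ α (dense_setOf_null_frontier_and_finite_inter (μ : Measure (QuadConfig D)) hα)
    fun Q₀ hQ₀ => ?_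
  exact exists_measurableSet_crossingField_ae_eq_of_frequently_gluing hD hD'.nonempty hlim hQ₀.1
    (h41 D hD hD' μ δs hpos h0 hlim α hα Q₀ hQ₀.1 hQ₀.2)

end QuadCrossing

end Literature.Probability.Percolation

end
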